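import Summits.QuantumFields.YangMills.Theorems.BalabanUVNodesN21ResponseRadialTransversality

/-!
# N21 (NE7c) · A2/A6 SANITY for the response rung: the JOINT binder system of
# `slotAntiConcentration_restrict_of_projectedCentre_quadraticResponse` (part 34's (M1) about the A-projected centre with
# `hRT` replaced by the response letters) is INHABITED — by a genuinely NONLINEAR response with a NON-EMPTY shell

Width seat `pub-ymgap-dag-n21-w3` (g0), node N21 = NE7c (NOT PRINTED in [Bałaban 1983–89], NOT proved), lane K3⁷
`SpineGivenEndpointR13SepCoPH` (stmt-QuantumFields-20544, `--kind proof --supports … --as helper`).  Companion of this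
seat's file 1 `…N21ResponseRadialTransversality` (p583660), whose §4 junction was filed LOCATED («A2: the joint system
is not exhibited here»).  THIS FILE exhibits it (A6 rule, director-ym №189): every binder of the junction — part 34's
`hg ∕ hUm ∕ hC ∕ hEnv ∕ hK ∕ hcK ∕ hP ∕ hobt ∕ hfar ∕ henv ∕ hQ` AND the response letters `hT ∕ hKR ∕ hc₀ ∕ hCK ∕ hnum` — is
discharged at once on explicit objects, and the shell event is non-empty there, so the junction is satisfiable AS
TYPED and its conclusion is not vacuous (§1).  §2 answers referee ref-O's READ-1 NIT-2 on p583660 (file 1's own toy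
`hRT_of_quadraticResponse_apply_witness` is vacuous: empty shell): the slope-3 re-witness `Φ w = 3w + w²∕4` in file 1's
toy frame (`X = Unit`, `V = E = ℝ`, `K = [−1,1]`, `M = ¼`, `R = 1`, `c₀ = 0`, `θ = 4`, `ρ = κ₀ = ½`), on which file 1's
§3 `hRT_of_quadraticResponse` fires with EVERY antecedent clause satisfied at `p = ((), 4∕5)`, `s = 1`
(`apply_witness_slope3_antecedent_inhabited`).

THE WITNESS.  Frame `X = Unit` (exterior law `dirac ()`), one block coordinate `κ = Fin 1`, one plaquette `P = Unit`;
kept cut `K = closedBall 0 1` (convex, radius `R = 1` about the centre `c = 0`); Gaussian species `A = 1` (`γ = 1`: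
`‖x‖² ≤ ⟨x, x⟩` on `Fin 1 → ℝ`), `P = 0` (`G = 0`), linear centre `m = 0`; the NONLINEAR response `Φ w = w₀ + w₀²∕4` with
linearisations `L_w = (1 + w₀∕2)·pr₀` and quadratic remainder `M = ¼` (`|remainder| = ¼(w′₀ − w₀)² ≤ ¼‖w′ − w‖²`), core
reading `c₀ = 0`; threshold `θ = 13∕10`, relative width `ρ = 3∕20` (so `θ(1−ρ) = 1.105`), rate `κ₀ = 9∕100` — the NUMERAL
`c₀ + 4MR² = 1 ≤ (1 − κ₀)θ(1−ρ) = 1.00555` holds; cut `C = Env = {p | p.2 ∈ K}`; odds `Q = 0` (on `C` the statistic is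
`≤ 5∕4 < θ`, so `Env ∖ ({U < θ} ∩ C) = ∅`).  The shell `{θ(1−ρ) ≤ U < θ} ∩ C` contains `w₀ = 1` (`U = 5∕4`).

v1.1 (g2, APPEND-ONLY; §1–§2 byte-identical) — referee ref-O READ-67 NITs (i)–(ii) CLOSED in §3: (i) at §1's numerals
`D·ρ = 78.43 × 0.15 ≥ 1`, so the (M1) bound held for every measure; `responseJunction_binders_inhabited_sharp` re-runs
the SAME witness at `(θ, ρ) = (63∕50, 1∕100)` where `D·ρ = 0.673… < 1` (`sharp_constant_mul_width_lt_one`), the numeral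
(`1 ≤ 1.1351`), the shell (`w₀ = 1`, `U = 5∕4 ∈ [1.2474, 1.26)`) and `hQ` (`5∕4 < 63∕50`) still good — the bound is now
EXERCISED; (ii) §2's antecedent was inhabited only at `s = 1`; `apply_witness_slope3_antecedent_inhabited_dilate`
inhabits it at the genuine dilate `s = 5∕4` (`p = 4∕5 ↦ 1`, `U = 13∕4 ∈ [2, 4)`), where §2's conclusion gains `¼`.

HONEST FRAMING.  [textbook]; a satisfiability witness, not an estimate on Bałaban's measure; nothing of Bałaban's
asserted; NE7c NOT PRINTED ∕ NOT proved; N21 NOT discharged; counts unmoved (typed 28∕28 · discharged 5∕27);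
count-neutral; one finite 𝕋⁴ at fixed ε — YM mass gap (Clay) is NOT proved by any of this: R4 closes the conditional
finite-𝕋⁴ rung `BalabanLadder.UV` only; nothing continuum ∕ ℝ⁴ ∕ OS ∕ mass gap ∕ Clay.
-/

open MeasureTheory Set Function Matrix Metric
open scoped ENNReal

namespace Summit.QuantumFields.YangMills.Theorems.N21ResponseRadialTransversalitySanity

open Literature.MathematicalPhysics.QuantumFieldTheory.Balaban1983to89.T4ShellMeasure (SlotAntiConcentration)
open Summit.QuantumFields.YangMills.Theorems.N21ResponseRadialTransversality
  (hRT_of_quadraticResponse slotAntiConcentration_restrict_of_projectedCentre_quadraticResponse)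

/-- the Gaussian species `A = 1` is `1`-coercive for the sup norm on `Fin 1 → ℝ` (the sup norm of `x : Fin 1 → ℝ` is
`|x 0|` — cf. `Literature.AlgebraicTopology.Homotopy.SerreInvariantCycles.norm_fin_one`, not imported here; only the
inequality `‖x‖ ≤ |x 0|` is used, inline). [textbook] -/
theorem coercive_one_fin_one (x : Fin 1 → ℝ) : 1 * ‖x‖ ^ 2 ≤ x ⬝ᵥ ((1 : Matrix (Fin 1) (Fin 1) ℝ) *ᵥ x) := by
  have hle : ‖x‖ ≤ |x 0| :=
    (pi_norm_le_iff_of_nonneg (abs_nonneg _)).2 fun i => by rw [Subsingleton.elim i 0, Real.norm_eq_abs]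
  rw [Matrix.one_mulVec, one_mul, dotProduct, Fin.sum_univ_one, ← pow_two, ← sq_abs (x 0)]
  exact pow_le_pow_left₀ (norm_nonneg x) hle 2

/-- the witness response's quadratic remainder in the block frame: `≤ ¼‖w′ − w‖²`. [textbook] -/
theorem witness_remainder_fin_one (w w' : Fin 1 → ℝ) :
    ‖(w' 0 + w' 0 ^ 2 / 4) - (w 0 + w 0 ^ 2 / 4)
        - ((1 + w 0 / 2) • LinearMap.proj (R := ℝ) (φ := fun _ : Fin 1 => ℝ) 0) (w' - w)‖
      ≤ 1 / 4 * ‖w' - w‖ ^ 2 := by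
  have hcoord : |(w' - w) 0| ≤ ‖w' - w‖ := by rw [← Real.norm_eq_abs]; exact norm_le_pi_norm (w' - w) 0
  simp only [LinearMap.smul_apply, LinearMap.coe_proj, Function.eval, Pi.sub_apply, smul_eq_mul,
    Real.norm_eq_abs]
  rw [show w' 0 + w' 0 ^ 2 / 4 - (w 0 + w 0 ^ 2 / 4) - (1 + w 0 / 2) * (w' 0 - w 0)
      = 1 / 4 * (w' 0 - w 0) ^ 2 by ring, abs_mul, abs_of_pos (by norm_num : (0 : ℝ) < 1 / 4), abs_pow]
  have h0 : 0 ≤ |w' 0 - w 0| := abs_nonneg _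
  rw [Pi.sub_apply] at hcoord
  nlinarith [hcoord, norm_nonneg (w' - w)]

/-- on the cut `{p | p.2 ∈ closedBall 0 1}` the witness statistic is `≤ 5∕4`. [textbook] -/
theorem witness_stat_le {w : Fin 1 → ℝ} (hw : w ∈ closedBall (0 : Fin 1 → ℝ) 1) :
    ‖w 0 + w 0 ^ 2 / 4‖ ≤ 5 / 4 := by
  rw [mem_closedBall, dist_zero_right] at hw
  replace hw : |w 0| ≤ 1 := by rw [← Real.norm_eq_abs]; exact (norm_le_pi_norm w 0).trans hw
  rw [Real.norm_eq_abs]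
  have h1 : |w 0| ^ 2 ≤ 1 := by nlinarith [abs_nonneg (w 0)]
  calc |w 0 + w 0 ^ 2 / 4| ≤ |w 0| + |w 0 ^ 2 / 4| := abs_add_le _ _
    _ = |w 0| + |w 0| ^ 2 / 4 := by rw [abs_div, abs_pow, abs_of_pos (by norm_num : (0 : ℝ) < 4)]
    _ ≤ 5 / 4 := by linarith

/-- **THE SHELL OF THE WITNESS IS NON-EMPTY** (so the (M1) conclusion below is not about an empty event): the point
`w₀ = 1` lies in the cut and its statistic `5∕4` lies in `[θ(1−ρ), θ) = [1.105, 1.3)`. [textbook] -/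
theorem witness_shell_nonempty :
    ((), fun _ : Fin 1 => (1 : ℝ)) ∈
      {p : Unit × (Fin 1 → ℝ) | (13 / 10 : ℝ) * (1 - 3 / 20) ≤ (⨆ _ : Unit, ‖p.2 0 + p.2 0 ^ 2 / 4‖) ∧
          (⨆ _ : Unit, ‖p.2 0 + p.2 0 ^ 2 / 4‖) < 13 / 10} ∩
        {p : Unit × (Fin 1 → ℝ) | p.2 ∈ closedBall (0 : Fin 1 → ℝ) 1} := by
  refine ⟨?_, ?_⟩
  · simp only [mem_setOf_eq, ciSup_const]
    norm_num
  · simp only [mem_setOf_eq, mem_closedBall, dist_zero_right]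
    exact (pi_norm_le_iff_of_nonneg zero_le_one).2 fun _ => by simp

/-- ★ **A2/A6 — THE JOINT BINDER SYSTEM OF FILE 1's §4 JUNCTION IS INHABITED**: part 34's (M1) about the A-projected
centre with `hRT` replaced by the response letters, APPLIED with every binder discharged on the witness described in
the module docstring (nonlinear response `w₀ + w₀²∕4`, `M = ¼`, `R = 1`, `c₀ = 0`, `θ = 13∕10`, `ρ = 3∕20`, `κ₀ = 9∕100`,
`Q = 0`).  A satisfiability witness, not an estimate on Bałaban's measure. [textbook] -/
theorem responseJunction_binders_inhabited :
    SlotAntiConcentration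
      ((((Measure.dirac ()).prod (volume : Measure (Fin 1 → ℝ))).withDensity
          fun p : Unit × (Fin 1 → ℝ) =>
            (closedBall (0 : Fin 1 → ℝ) 1).indicator (fun w => ENNReal.ofReal (Real.exp
              (-(1 / 2 * ((w - (0 : Fin 1 → ℝ)) ⬝ᵥ ((1 : Matrix (Fin 1) (Fin 1) ℝ) *ᵥ (w - 0))) + (0 : ℝ)))))
              p.2).restrict
        ({p : Unit × (Fin 1 → ℝ) | (⨆ _ : Unit, ‖p.2 0 + p.2 0 ^ 2 / 4‖) < 13 / 10} ∩
          {p : Unit × (Fin 1 → ℝ) | p.2 ∈ closedBall (0 : Fin 1 → ℝ) 1}))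
      (fun p : Unit × (Fin 1 → ℝ) => ⨆ _ : Unit, ‖p.2 0 + p.2 0 ^ 2 / 4‖) (13 / 10) (3 / 20)
      (3 * ((Fintype.card (Fin 1) : ℝ) + 1) * (1 + 0) / (9 / 100 * (1 - 3 / 20))) := by
  -- measurability of the density: a measurable function of the block coordinate under a measurable kept cut
  have hq : Measurable fun w : Fin 1 → ℝ =>
      ENNReal.ofReal (Real.exp (-(1 / 2 * ((w - (0 : Fin 1 → ℝ)) ⬝ᵥ ((1 : Matrix (Fin 1) (Fin 1) ℝ) *ᵥ (w - 0)))
        + (0 : ℝ)))) := by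
    have hc : Continuous fun w : Fin 1 → ℝ =>
        (w - (0 : Fin 1 → ℝ)) ⬝ᵥ ((1 : Matrix (Fin 1) (Fin 1) ℝ) *ᵥ (w - 0)) :=
      (continuous_id.sub continuous_const).dotProduct
        (continuous_const.matrix_mulVec (continuous_id.sub continuous_const))
    exact ENNReal.measurable_ofReal.comp (Real.measurable_exp.comp
      (((hc.measurable.const_mul (1 / 2)).add_const 0).neg))
  have hg : Measurable fun p : Unit × (Fin 1 → ℝ) =>
      (closedBall (0 : Fin 1 → ℝ) 1).indicator (fun w => ENNReal.ofReal (Real.exp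
        (-(1 / 2 * ((w - (0 : Fin 1 → ℝ)) ⬝ᵥ ((1 : Matrix (Fin 1) (Fin 1) ℝ) *ᵥ (w - 0))) + (0 : ℝ))))) p.2 :=
    (hq.indicator measurableSet_closedBall).comp measurable_snd
  have hU0 : Measurable fun p : Unit × (Fin 1 → ℝ) => ‖p.2 0 + p.2 0 ^ 2 / 4‖ :=
    (((measurable_pi_apply 0).comp measurable_snd).add
      ((((measurable_pi_apply 0).comp measurable_snd).pow_const 2).div_const 4)).norm
  have hUm : Measurable fun p : Unit × (Fin 1 → ℝ) => ⨆ _ : Unit, ‖p.2 0 + p.2 0 ^ 2 / 4‖ := by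
    simp only [ciSup_const]; exact hU0
  have hC : MeasurableSet {p : Unit × (Fin 1 → ℝ) | p.2 ∈ closedBall (0 : Fin 1 → ℝ) 1} :=
    measurableSet_closedBall.preimage measurable_snd
  refine slotAntiConcentration_restrict_of_projectedCentre_quadraticResponse (P := Unit) (Measure.dirac ())
    (fun _ => closedBall (0 : Fin 1 → ℝ) 1) 1 Matrix.isSymm_one (γ := 1) (G := 0) one_pos coercive_one_fin_one
    (fun _ => 0) (c := fun _ => 0) measurable_const (fun _ _ => 0) hg
    (fun (_ : Unit) (_ : Unit) (w : Fin 1 → ℝ) => w 0 + w 0 ^ 2 / 4)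
    (fun (_ : Unit) (_ : Unit) (w : Fin 1 → ℝ) => (1 + w 0 / 2) • LinearMap.proj 0)
    (M := 1 / 4) (R := 1) (c₀ := 0) (by norm_num) (fun _ _ w _ w' _ => witness_remainder_fin_one w w')
    (fun _ w hw => by rwa [sub_zero, ← dist_zero_right]) (fun _ _ => by norm_num) hUm hC hC (fun p hp => hp)
    (κ₀ := 9 / 100) (Q := 0) (by norm_num) (by norm_num) (by norm_num) (by norm_num) le_rfl (by norm_num)
    (fun _ => convex_closedBall 0 1) (fun _ => mem_closedBall_self zero_le_one) (fun _ _ _ _ _ => by simp)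
    (fun _ _ _ _ _ => by simp) (fun p _ _ _ _ => by rw [mul_zero]; positivity) ?_ ?_
  · -- henv: inward dilates of cut points stay in the cut (= Env)
    intro l hl p _ _ hpC
    have hl0 : 0 ≤ l := by
      have h := hl.1
      simp only [Fintype.card_fin, Nat.cast_one] at h
      linarith
    simp only [mem_setOf_eq, mem_closedBall, dist_zero_right, zero_add, sub_zero, norm_smul,
      Real.norm_of_nonneg hl0] at hpC ⊢
    calc l * ‖p.2‖ ≤ 1 * 1 := mul_le_mul hl.2 hpC (norm_nonneg _) zero_le_one
      _ = 1 := one_mul 1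
  · -- hQ with Q = 0: on the cut the statistic is ≤ 5/4 < θ, so Env \ ({U < θ} ∩ C) = ∅
    have hempty : {p : Unit × (Fin 1 → ℝ) | p.2 ∈ closedBall (0 : Fin 1 → ℝ) 1} \
        ({p : Unit × (Fin 1 → ℝ) | (⨆ _ : Unit, ‖p.2 0 + p.2 0 ^ 2 / 4‖) < 13 / 10} ∩
          {p : Unit × (Fin 1 → ℝ) | p.2 ∈ closedBall (0 : Fin 1 → ℝ) 1}) = ∅ := by
      rw [sdiff_eq_empty]
      intro p hp
      refine ⟨?_, hp⟩
      simp only [mem_setOf_eq, ciSup_const]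
      exact (witness_stat_le hp).trans_lt (by norm_num)
    rw [hempty, measure_empty]
    exact bot_le

/-! ## §2  A NON-VACUOUS witness for file 1's §3 alone (one real block variable, slope `3`; ref-O READ-1 NIT-2) -/

/-- the slope-3 witness response `Φ w = 3w + w²∕4` with linearisations `L_w = (3 + w∕2)·id` has quadratic remainder
EXACTLY `¼(w′ − w)²` (same `M = ¼` as file 1's §5 toy). [textbook] -/
theorem witness_remainder_slope3 (w w' : ℝ) :
    ‖(3 * w' + w' ^ 2 / 4) - (3 * w + w ^ 2 / 4) - ((3 + w / 2) • LinearMap.id (R := ℝ) (M := ℝ)) (w' - w)‖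
      = 1 / 4 * ‖w' - w‖ ^ 2 := by
  simp only [LinearMap.smul_apply, LinearMap.id_coe, id_eq, smul_eq_mul, Real.norm_eq_abs]
  rw [← abs_pow, show 3 * w' + w' ^ 2 / 4 - (3 * w + w ^ 2 / 4) - (3 + w / 2) * (w' - w) = 1 / 4 * (w' - w) ^ 2 by
    ring, abs_mul, abs_of_pos (by norm_num : (0 : ℝ) < 1 / 4)]

/-- **§3 FIRES ON THE SLOPE-3 WITNESS** (frame `X = Unit`, `V = E = ℝ`, one plaquette `P = Unit`, cut
`C = {p | p.2 ∈ [−1, 1]}`, centre `0`, `M = ¼`, `R = 1`, `c₀ = 0`, `θ = 4`, `ρ = κ₀ = ½`, numeral `1 ≤ ½·2`): the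
discharged `hRT` for `U p = ⨆ _, ‖3p.2 + p.2²∕4‖`; its shell `{2 ≤ U < 4} ∩ C` is NON-EMPTY
(`apply_witness_slope3_antecedent_inhabited`). [textbook] -/
theorem hRT_of_quadraticResponse_apply_witness_slope3 :
    ∀ p : Unit × ℝ, 4 * (1 - 1 / 2) ≤ (⨆ _ : Unit, ‖3 * p.2 + p.2 ^ 2 / 4‖) →
      (⨆ _ : Unit, ‖3 * p.2 + p.2 ^ 2 / 4‖) < 4 →
      p ∈ {p : Unit × ℝ | p.2 ∈ Icc (-1 : ℝ) 1} → ∀ s : ℝ, 1 ≤ s →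
      4 * (1 - 1 / 2) ≤ (⨆ _ : Unit, ‖3 * (0 + s • (p.2 - 0)) + (0 + s • (p.2 - 0)) ^ 2 / 4‖) →
        (⨆ _ : Unit, ‖3 * (0 + s • (p.2 - 0)) + (0 + s • (p.2 - 0)) ^ 2 / 4‖) < 4 →
          (p.1, (0 : ℝ) + s • (p.2 - 0)) ∈ {p : Unit × ℝ | p.2 ∈ Icc (-1 : ℝ) 1} →
          (⨆ _ : Unit, ‖3 * p.2 + p.2 ^ 2 / 4‖) + 1 / 2 * (4 * (1 - 1 / 2)) * (s - 1)
            ≤ ⨆ _ : Unit, ‖3 * (0 + s • (p.2 - 0)) + (0 + s • (p.2 - 0)) ^ 2 / 4‖ :=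
  hRT_of_quadraticResponse (X := Unit) (V := ℝ) (E := ℝ) (P := Unit)
    (fun _ _ w => 3 * w + w ^ 2 / 4) (fun _ _ w => (3 + w / 2) • LinearMap.id) (fun _ => Icc (-1) 1) (fun _ => 0)
    (M := 1 / 4) (R := 1) (c₀ := 0) (θ := 4) (ρ := 1 / 2) (κ₀ := 1 / 2) (by norm_num)
    (fun _ _ w _ w' _ => (witness_remainder_slope3 w w').le) (fun _ => ⟨by norm_num, by norm_num⟩)
    (fun _ w hw => by rw [sub_zero, Real.norm_eq_abs, abs_le]; exact hw) (fun _ _ => by norm_num)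
    (fun p hp => hp) (by norm_num)

/-- **THE ANTECEDENT OF `hRT_of_quadraticResponse_apply_witness_slope3` IS INHABITED**: at `p = ((), 4∕5)` and
`s = 1` every clause holds — the statistic `|3·(4∕5) + (4∕5)²∕4| = 64∕25 ∈ [2, 4)`, `4∕5 ∈ [−1, 1]`, the dilate is `p`
itself — so §3's conclusion is exercised on a non-empty shell (answers ref-O READ-1 NIT-2 on p583660). [textbook] -/
theorem apply_witness_slope3_antecedent_inhabited :
    ∃ (p : Unit × ℝ) (s : ℝ), 4 * (1 - 1 / 2) ≤ (⨆ _ : Unit, ‖3 * p.2 + p.2 ^ 2 / 4‖) ∧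
      (⨆ _ : Unit, ‖3 * p.2 + p.2 ^ 2 / 4‖) < 4 ∧
      p ∈ {p : Unit × ℝ | p.2 ∈ Icc (-1 : ℝ) 1} ∧ 1 ≤ s ∧
      4 * (1 - 1 / 2) ≤ (⨆ _ : Unit, ‖3 * (0 + s • (p.2 - 0)) + (0 + s • (p.2 - 0)) ^ 2 / 4‖) ∧
        (⨆ _ : Unit, ‖3 * (0 + s • (p.2 - 0)) + (0 + s • (p.2 - 0)) ^ 2 / 4‖) < 4 ∧
          (p.1, (0 : ℝ) + s • (p.2 - 0)) ∈ {p : Unit × ℝ | p.2 ∈ Icc (-1 : ℝ) 1} := by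
  refine ⟨((), 4 / 5), 1, ?_, ?_, ?_, le_rfl, ?_, ?_, ?_⟩ <;>
    simp only [ciSup_const, mem_setOf_eq, mem_Icc, one_smul, sub_zero, zero_add, Real.norm_eq_abs] <;>
    norm_num [abs_of_pos]

/-! ## §3  v1.1 (g2): referee ref-O READ-67 NITs (i)–(ii) — the (M1) bound exercised (`D·ρ < 1`) and the slope-3
antecedent at a genuine dilate `s = 5∕4` -/

/-- at `(θ, ρ, κ₀, Q) = (63∕50, 1∕100, 9∕100, 0)` the (M1) constant times the width is `< 1`:
`3(#κ+1)(1+Q)∕(κ₀(1−ρ)) · ρ = 6∕(0.09·0.99)·0.01 = 0.673… < 1` — the bound `μ(shell) ≤ D·ρ·μ(univ)` is NOT automatic.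
[bookkeeping] -/
theorem sharp_constant_mul_width_lt_one :
    3 * ((Fintype.card (Fin 1) : ℝ) + 1) * (1 + 0) / (9 / 100 * (1 - 1 / 100)) * (1 / 100) < 1 := by
  simp only [Fintype.card_fin, Nat.cast_one]
  norm_num

/-- the shell at `(θ, ρ) = (63∕50, 1∕100)` still contains `w₀ = 1` (`U = 5∕4 ∈ [1.2474, 1.26)`). [textbook] -/
theorem witness_shell_nonempty_sharp :
    ((), fun _ : Fin 1 => (1 : ℝ)) ∈
      {p : Unit × (Fin 1 → ℝ) | (63 / 50 : ℝ) * (1 - 1 / 100) ≤ (⨆ _ : Unit, ‖p.2 0 + p.2 0 ^ 2 / 4‖) ∧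
          (⨆ _ : Unit, ‖p.2 0 + p.2 0 ^ 2 / 4‖) < 63 / 50} ∩
        {p : Unit × (Fin 1 → ℝ) | p.2 ∈ closedBall (0 : Fin 1 → ℝ) 1} := by
  refine ⟨?_, ?_⟩
  · simp only [mem_setOf_eq, ciSup_const]
    norm_num
  · simp only [mem_setOf_eq, mem_closedBall, dist_zero_right]
    exact (pi_norm_le_iff_of_nonneg zero_le_one).2 fun _ => by simp

/-- ★ **v1.1 — THE SAME WITNESS WITH THE (M1) BOUND EXERCISED** (ref-O READ-67 NIT (i)): §1's junction applied with
every binder discharged at `(θ, ρ) = (63∕50, 1∕100)` (all other data as in §1: response `w₀ + w₀²∕4`, `M = ¼`, `R = 1`,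
`c₀ = 0`, `κ₀ = 9∕100`, `Q = 0`), where the constant satisfies `D·ρ < 1` (`sharp_constant_mul_width_lt_one`) and the shell
is non-empty (`witness_shell_nonempty_sharp`). [textbook] -/
theorem responseJunction_binders_inhabited_sharp :
    SlotAntiConcentration
      ((((Measure.dirac ()).prod (volume : Measure (Fin 1 → ℝ))).withDensity
          fun p : Unit × (Fin 1 → ℝ) =>
            (closedBall (0 : Fin 1 → ℝ) 1).indicator (fun w => ENNReal.ofReal (Real.exp
              (-(1 / 2 * ((w - (0 : Fin 1 → ℝ)) ⬝ᵥ ((1 : Matrix (Fin 1) (Fin 1) ℝ) *ᵥ (w - 0))) + (0 : ℝ)))))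
              p.2).restrict
        ({p : Unit × (Fin 1 → ℝ) | (⨆ _ : Unit, ‖p.2 0 + p.2 0 ^ 2 / 4‖) < 63 / 50} ∩
          {p : Unit × (Fin 1 → ℝ) | p.2 ∈ closedBall (0 : Fin 1 → ℝ) 1}))
      (fun p : Unit × (Fin 1 → ℝ) => ⨆ _ : Unit, ‖p.2 0 + p.2 0 ^ 2 / 4‖) (63 / 50) (1 / 100)
      (3 * ((Fintype.card (Fin 1) : ℝ) + 1) * (1 + 0) / (9 / 100 * (1 - 1 / 100))) := by
  -- measurability of the density: a measurable function of the block coordinate under a measurable kept cut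
  have hq : Measurable fun w : Fin 1 → ℝ =>
      ENNReal.ofReal (Real.exp (-(1 / 2 * ((w - (0 : Fin 1 → ℝ)) ⬝ᵥ ((1 : Matrix (Fin 1) (Fin 1) ℝ) *ᵥ (w - 0)))
        + (0 : ℝ)))) := by
    have hc : Continuous fun w : Fin 1 → ℝ =>
        (w - (0 : Fin 1 → ℝ)) ⬝ᵥ ((1 : Matrix (Fin 1) (Fin 1) ℝ) *ᵥ (w - 0)) :=
      (continuous_id.sub continuous_const).dotProduct
        (continuous_const.matrix_mulVec (continuous_id.sub continuous_const))
    exact ENNReal.measurable_ofReal.comp (Real.measurable_exp.comp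
      (((hc.measurable.const_mul (1 / 2)).add_const 0).neg))
  have hg : Measurable fun p : Unit × (Fin 1 → ℝ) =>
      (closedBall (0 : Fin 1 → ℝ) 1).indicator (fun w => ENNReal.ofReal (Real.exp
        (-(1 / 2 * ((w - (0 : Fin 1 → ℝ)) ⬝ᵥ ((1 : Matrix (Fin 1) (Fin 1) ℝ) *ᵥ (w - 0))) + (0 : ℝ))))) p.2 :=
    (hq.indicator measurableSet_closedBall).comp measurable_snd
  have hU0 : Measurable fun p : Unit × (Fin 1 → ℝ) => ‖p.2 0 + p.2 0 ^ 2 / 4‖ :=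
    (((measurable_pi_apply 0).comp measurable_snd).add
      ((((measurable_pi_apply 0).comp measurable_snd).pow_const 2).div_const 4)).norm
  have hUm : Measurable fun p : Unit × (Fin 1 → ℝ) => ⨆ _ : Unit, ‖p.2 0 + p.2 0 ^ 2 / 4‖ := by
    simp only [ciSup_const]; exact hU0
  have hC : MeasurableSet {p : Unit × (Fin 1 → ℝ) | p.2 ∈ closedBall (0 : Fin 1 → ℝ) 1} :=
    measurableSet_closedBall.preimage measurable_snd
  refine slotAntiConcentration_restrict_of_projectedCentre_quadraticResponse (P := Unit) (Measure.dirac ())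
    (fun _ => closedBall (0 : Fin 1 → ℝ) 1) 1 Matrix.isSymm_one (γ := 1) (G := 0) one_pos coercive_one_fin_one
    (fun _ => 0) (c := fun _ => 0) measurable_const (fun _ _ => 0) hg
    (fun (_ : Unit) (_ : Unit) (w : Fin 1 → ℝ) => w 0 + w 0 ^ 2 / 4)
    (fun (_ : Unit) (_ : Unit) (w : Fin 1 → ℝ) => (1 + w 0 / 2) • LinearMap.proj 0)
    (M := 1 / 4) (R := 1) (c₀ := 0) (by norm_num) (fun _ _ w _ w' _ => witness_remainder_fin_one w w')
    (fun _ w hw => by rwa [sub_zero, ← dist_zero_right]) (fun _ _ => by norm_num) hUm hC hC (fun p hp => hp)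
    (κ₀ := 9 / 100) (Q := 0) (by norm_num) (by norm_num) (by norm_num) (by norm_num) le_rfl (by norm_num)
    (fun _ => convex_closedBall 0 1) (fun _ => mem_closedBall_self zero_le_one) (fun _ _ _ _ _ => by simp)
    (fun _ _ _ _ _ => by simp) (fun p _ _ _ _ => by rw [mul_zero]; positivity) ?_ ?_
  · -- henv: inward dilates of cut points stay in the cut (= Env)
    intro l hl p _ _ hpC
    have hl0 : 0 ≤ l := by
      have h := hl.1
      simp only [Fintype.card_fin, Nat.cast_one] at h
      linarith
    simp only [mem_setOf_eq, mem_closedBall, dist_zero_right, zero_add, sub_zero, norm_smul,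
      Real.norm_of_nonneg hl0] at hpC ⊢
    calc l * ‖p.2‖ ≤ 1 * 1 := mul_le_mul hl.2 hpC (norm_nonneg _) zero_le_one
      _ = 1 := one_mul 1
  · -- hQ with Q = 0: on the cut the statistic is ≤ 5/4 < θ, so Env \ ({U < θ} ∩ C) = ∅
    have hempty : {p : Unit × (Fin 1 → ℝ) | p.2 ∈ closedBall (0 : Fin 1 → ℝ) 1} \
        ({p : Unit × (Fin 1 → ℝ) | (⨆ _ : Unit, ‖p.2 0 + p.2 0 ^ 2 / 4‖) < 63 / 50} ∩
          {p : Unit × (Fin 1 → ℝ) | p.2 ∈ closedBall (0 : Fin 1 → ℝ) 1}) = ∅ := by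
      rw [sdiff_eq_empty]
      intro p hp
      refine ⟨?_, hp⟩
      simp only [mem_setOf_eq, ciSup_const]
      exact (witness_stat_le hp).trans_lt (by norm_num)
    rw [hempty, measure_empty]
    exact bot_le

/-- **v1.1 — THE SLOPE-3 ANTECEDENT AT A GENUINE DILATE** (ref-O READ-67 NIT (ii)): at `p = ((), 4∕5)` and `s = 5∕4 > 1`
every clause of `hRT_of_quadraticResponse_apply_witness_slope3` holds — the dilate is `1 ∈ [−1, 1]` with statistic
`13∕4 ∈ [2, 4)` — so §2's conclusion is exercised with the positive gain `½·2·¼ = ¼`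
(`64∕25 + ¼ ≤ 13∕4`). [textbook] -/
theorem apply_witness_slope3_antecedent_inhabited_dilate :
    ∃ (p : Unit × ℝ) (s : ℝ), 1 < s ∧ 4 * (1 - 1 / 2) ≤ (⨆ _ : Unit, ‖3 * p.2 + p.2 ^ 2 / 4‖) ∧
      (⨆ _ : Unit, ‖3 * p.2 + p.2 ^ 2 / 4‖) < 4 ∧
      p ∈ {p : Unit × ℝ | p.2 ∈ Icc (-1 : ℝ) 1} ∧ 1 ≤ s ∧
      4 * (1 - 1 / 2) ≤ (⨆ _ : Unit, ‖3 * (0 + s • (p.2 - 0)) + (0 + s • (p.2 - 0)) ^ 2 / 4‖) ∧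
        (⨆ _ : Unit, ‖3 * (0 + s • (p.2 - 0)) + (0 + s • (p.2 - 0)) ^ 2 / 4‖) < 4 ∧
          (p.1, (0 : ℝ) + s • (p.2 - 0)) ∈ {p : Unit × ℝ | p.2 ∈ Icc (-1 : ℝ) 1} := by
  refine ⟨((), 4 / 5), 5 / 4, by norm_num, ?_, ?_, ?_, by norm_num, ?_, ?_, ?_⟩ <;>
    simp only [ciSup_const, mem_setOf_eq, mem_Icc, smul_eq_mul, sub_zero, zero_add, Real.norm_eq_abs] <;>
    norm_num [abs_of_pos]

end Summit.QuantumFields.YangMills.Theorems.N21ResponseRadialTransversalitySanity
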